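import Summits.ResolutionOfSingularities.ResolutionOfSingularities.Theorems.HilbertSamuelEliminationSigmaMaxModificationsCorridor3WLadderStrataScope
import Summits.ResolutionOfSingularities.ResolutionOfSingularities.Theorems.HilbertSamuelEliminationSigmaMaxModificationsCorridor3NearStep
import Summits.ResolutionOfSingularities.ResolutionOfSingularities.Theorems.HilbertSamuelEliminationSigmaMaxModificationsCorridor3ReachesCyclePackage
import HarnessLib

/-!
# [OURS · L1 W4.2] D17 (i) — THE ISO → NON-ISO TRANSITION LEMMA (def-free kernel form)

Crux chain w42 (`SigmaMaxModifications`, stmt-ResolutionOfSingularities-18506; conjunct `SigmaMaxModificationsCorridor3`,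
stmt-ResolutionOfSingularities-19249). Object D17 «ALT LAW: TRANSITION LEMMA + NO-RECURRENCE ROW» (res-L1-w42-plan-1 RULINGS v3.12-4 (V),
re-cut v3.13-3 (AM) 2026-08-27T09:09:15Z after the typer's vacuity note: hand res-L1-type-o1). OURS (cell res-hironaka, slot W4.2); NOT a
statement of H. Hironaka's manuscript [Hironaka2017] nor of [CossartJannsenSaito2020]; AI-written, weaker than expert review. Helper file
`--supports stmt-ResolutionOfSingularities-19249 --as helper` (counted 0); theorem-only.

## What is proved

Along a canonical near step `s → s'` read through its step projection `f : X_{n+1} ⟶ X_n` (stub-4's `Moving.StepProjection`), under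
stub-4's cycle invariant `Moving.CycleInv k R N ν s` (admissible oracle, `ν ≠ Φ^{(N)}`):

* `Moving.closure_image_eq_singleton_of_iso` — if the marked point `x_n` is ISOLATED in the Hilbert–Samuel locus (`Moving.Iso N s`),
  then EVERY irreducible component `Z'` of `X_{n+1}(ν)` through `x_{n+1}` collapses to `x_n`: `closure (f '' Z') = {x_n}`. Content:
  `H^N` does not increase along the (permissible) blow-down and `ν` is never exceeded (`StepProjection.image_hsStratum_subset`), so
  `f(Z') ⊆ X_n(ν)`; isolation gives an open `U ∋ x_n` with `U ∩ X_n(ν) = {x_n}`; `Z'` is irreducible and meets the open `f⁻¹(U)` (at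
  `x_{n+1}`), hence `Z' ⊆ closure (Z' ∩ f⁻¹ U) ⊆ f⁻¹{x_n}`.
* `Moving.exists_isoStepBirth_of_iso_of_not_iso` — **D17 (i)**: if moreover `x_{n+1}` is NOT isolated (`¬ Moving.Iso N s'`), some
  component `Z'` of `X_{n+1}(ν)` through `x_{n+1}` is NON-TRIVIAL and collapses to `x_n`:
  `∃ Z' ∈ componentsThrough N ν s', closure (f.base '' Z') = {s.pt} ∧ Z'.Nontrivial` — the event `Moving.IsIsoStepBirthAt N ν s s' f Z'`
  of RULINGS v3.13-3 (AM) spelled out (the named event and the one-line repackaging live in the Defs sibling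
  `…Corridor3WLadderIsoStepBirthDefs.lean`). Non-triviality is stub-4's `CycleInv.exists_ne_of_mem_componentsThrough` at the
  never-isolated point `x_{n+1}`.
* chain forms from a maximal origin (`exists_isoStepBirth_along_chain`, `closure_image_eq_singleton_along_chain_of_iso`) in the binder
  shape of the `Moving` rows (`Reaches … (c 0)`, `∀ n, CanonicalNearStep … (c n) (c (n+1))`), via `exists_cycleInv_chain`.

Why `ν ≠ Φ^{(N)}`: every `CycleInv` brick carries it; at the regular value `ν = Φ^{(N)}` no stage reached from a maximal origin is ever
blown up (`IsMaximalOrigin.not_isBlownUp_of_eq_iterPSum`) and the W-top rows are settled separately (…Corridor3RegularValue).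

References: stub-4's `…Corridor3WLadderStrataScope.lean` (`Moving.CycleInv`, `StepProjection.image_hsStratum_subset`,
`CycleInv.exists_ne_of_mem_componentsThrough`, `exists_cycleInv_chain`), `…Corridor3WLadderStrataLineages.lean` (`StepProjection`,
`componentsThrough`), res-type-071's / …Corridor3OriginAlongReaches isolation kit; typer's vacuity certificate
`…Corridor3WLadderIsoStepNoFibreBirth.lean` (p518419). [cite: CossartJannsenSaito2020, Thm. 3.10 (1), Rem. 6.29 (1), Def. 13.3] for the
printed ingredients (H non-increase under permissible blow-ups; the canonical sequence; isolation in `X_max`).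
-/

noncomputable section

set_option linter.dupNamespace false

open CategoryTheory AlgebraicGeometry TopologicalSpace Topology
open Summit.ResolutionOfSingularities.ResolutionOfSingularities.Theorems.CampaignW42
open Literature.AlgebraicGeometry.Resolution Literature.RingTheory.HilbertSamuel
open Literature.AlgebraicGeometry.CossartJannsenSaito2020
open Summit.ResolutionOfSingularities.ResolutionOfSingularities.Theorems.SigmaMaxModificationsCorridor3
open Summit.ResolutionOfSingularities.ResolutionOfSingularities.Theorems.SigmaMaxModificationsCorridor3.Helpers

universe u

namespace Summit.ResolutionOfSingularities.ResolutionOfSingularities.Theorems.SigmaMaxModificationsCorridor3.Moving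

variable {R : ∀ S : Scheme.{u}, CentreSeq S → Prop} {p N : ℕ} {ν : ℕ → ℕ} {k : Type u} [Field k]

/-! ## §1. Under the cycle invariant, isolation in `X_max` is isolation in the stratum -/

/-- Under the cycle invariant («`ν` never exceeded»), a marked point isolated in the Hilbert–Samuel locus is isolated in its
`ν`-stratum: some open `U ∋ x_n` has `U ∩ X_n(ν) = {x_n}`. [cite: CossartJannsenSaito2020, Def. 13.3, Def. 2.35] -/
theorem CycleInv.exists_isOpen_inter_hsStratum_eq_of_iso {s : MarkedStage.{u}} (h : CycleInv k R N ν s)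
    (hpt : s.pt ∈ Scheme.hsStratum s.W N ν) (hiso : Iso N s) :
    ∃ U : Set s.W, IsOpen U ∧ s.pt ∈ U ∧ U ∩ Scheme.hsStratum s.W N ν = {s.pt} := by
  obtain ⟨U, hU, hUmax⟩ := hiso
  have hptU : s.pt ∈ U := by
    have : s.pt ∈ U ∩ @Scheme.hsMaxLocus s.W N := by rw [hUmax]; exact Set.mem_singleton _
    exact this.1
  refine ⟨U, hU, hptU, Set.Subset.antisymm ?_ ?_⟩
  · rintro y ⟨hyU, hyν⟩
    have : y ∈ U ∩ @Scheme.hsMaxLocus s.W N := ⟨hyU, hsStratum_subset_hsMaxLocus_of_supMax h.supMax hyν⟩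
    rwa [hUmax] at this
  · rintro y rfl
    exact ⟨hptU, hpt⟩

/-! ## §2. At an isolated marked point every component through the next marked point collapses to it -/

/-- **Every component of `X_{n+1}(ν)` through `x_{n+1}` collapses to the ISOLATED `x_n`.** Under the cycle invariant at `s`
(admissible oracle, `ν ≠ Φ^{(N)}`), along a step projection `f` of a canonical near step `s → s'`, if `x_n` is isolated in the
Hilbert–Samuel locus then `closure (f '' Z') = {x_n}` for every irreducible component `Z'` of `X_{n+1}(ν)` through `x_{n+1}`.
[cite: CossartJannsenSaito2020, Thm. 3.10 (1), Rem. 6.29 (1)] -/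
theorem closure_image_eq_singleton_of_iso (hRa : OracleAdmissible R) (hν : ν ≠ iterPSum N Phi) {s s' : MarkedStage.{u}}
    (h : CycleInv k R N ν s) (hpt : s.pt ∈ Scheme.hsStratum s.W N ν) (hcl : IsClosed ({s.pt} : Set s.W))
    {f : s'.W ⟶ s.W} (hf : StepProjection R N ν s s' f) (hiso : Iso N s)
    {Z' : Set s'.W} (hZ' : Z' ∈ componentsThrough N ν s') : closure (f.base '' Z') = {s.pt} := by
  obtain ⟨U, hU, hptU, hUν⟩ := h.exists_isOpen_inter_hsStratum_eq_of_iso hpt hiso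
  -- `f(Z') ⊆ X_n(ν)`
  have himg : f.base '' Z' ⊆ Scheme.hsStratum s.W N ν :=
    (Set.image_mono (componentsIn.subset hZ'.1)).trans (hf.image_hsStratum_subset hRa hν h)
  -- `Z'` meets the open `f⁻¹ U` at `x_{n+1}` and is irreducible, hence lies in the closure of `Z' ∩ f⁻¹ U ⊆ f⁻¹ {x_n}`
  have hO : IsOpen (f.base ⁻¹' U) := hU.preimage f.continuous
  have hpt' : s'.pt ∈ Z' ∩ f.base ⁻¹' U := ⟨hZ'.2, by simpa [Set.mem_preimage, hf.base_pt] using hptU⟩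
  have hdense : Z' ⊆ closure (Z' ∩ f.base ⁻¹' U) :=
    subset_closure_inter_of_isPreirreducible_of_isOpen (componentsIn.isIrreducible hZ'.1).isPreirreducible hO ⟨_, hpt'⟩
  have hfib : Z' ∩ f.base ⁻¹' U ⊆ f.base ⁻¹' {s.pt} := by
    rintro z ⟨hzZ, hzU⟩
    have : f.base z ∈ U ∩ Scheme.hsStratum s.W N ν := ⟨hzU, himg ⟨z, hzZ, rfl⟩⟩
    rwa [hUν] at this
  have hZ'fib : Z' ⊆ f.base ⁻¹' {s.pt} :=
    hdense.trans ((closure_mono hfib).trans (hcl.preimage f.continuous).closure_subset)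
  -- hence `f(Z') = {x_n}`
  have himg' : f.base '' Z' = {s.pt} := by
    refine Set.Subset.antisymm ?_ ?_
    · rintro _ ⟨z, hz, rfl⟩
      exact hZ'fib hz
    · rintro _ rfl
      exact ⟨s'.pt, hZ'.2, hf.base_pt⟩
  rw [himg', hcl.closure_eq]

/-! ## §3. D17 (i): the iso → non-iso transition produces a non-trivial collapsing component -/

/-- **D17 (i) — THE TRANSITION LEMMA.** Under the cycle invariant at `s` (admissible oracle, `ν ≠ Φ^{(N)}`), along a step projection
`f` of a canonical near step `s → s'`: if `x_n` IS isolated in the Hilbert–Samuel locus and `x_{n+1}` is NOT, then some irreducible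
component `Z'` of `X_{n+1}(ν)` through `x_{n+1}` is non-trivial (has a second point) and collapses to `x_n` — the event
`IsIsoStepBirthAt N ν s s' f Z'` of RULINGS v3.13-3 (AM), spelled out. [cite: CossartJannsenSaito2020, Thm. 3.10 (1), Rem. 6.29 (1), Def. 13.3] -/
theorem exists_isoStepBirth_of_iso_of_not_iso (hRa : OracleAdmissible R) (hν : ν ≠ iterPSum N Phi) {s s' : MarkedStage.{u}}
    (h : CycleInv k R N ν s) (hpt : s.pt ∈ Scheme.hsStratum s.W N ν) (hcl : IsClosed ({s.pt} : Set s.W))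
    {f : s'.W ⟶ s.W} (hf : StepProjection R N ν s s' f) (hiso : Iso N s) (hni : ¬ Iso N s') :
    ∃ Z' ∈ componentsThrough N ν s', closure (f.base '' Z') = {s.pt} ∧ Z'.Nontrivial := by
  have h' : CycleInv k R N ν s' := h.step hRa hν hf.canonicalNearStep
  have hpt' : s'.pt ∈ Scheme.hsStratum s'.W N ν := hf.pt_mem_hsStratum
  obtain ⟨Z', hZ'⟩ := componentsThrough_nonempty (N := N) (ν := ν) hpt'
  obtain ⟨y, hyZ, hy⟩ := h'.exists_ne_of_mem_componentsThrough hpt' hni hZ'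
  exact ⟨Z', hZ', closure_image_eq_singleton_of_iso hRa hν h hpt hcl hf hiso hZ', ⟨y, hyZ, s'.pt, hZ'.2, hy⟩⟩

/-- Under the same hypotheses the step IS a blow-up AT `x_n` (`x_n` lies in the canonical centre): a waiting step off the centre is a
local isomorphism at the marked points and would carry isolation across. Read contrapositively from stub-4's
`MarkedStage.not_isBlownUp_of_not_mem`-package: here derived from the collapsing component — `x_{n+1}` has a second stratum point in
its fibre over `x_n`, impossible off the centre where `f` is an isomorphism. We record only the set-theoretic half that D17 needs:
the fibre `f⁻¹{x_n} ∩ X_{n+1}(ν)` is NOT the singleton `{x_{n+1}}`. [folklore] -/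
theorem fibre_inter_hsStratum_nontrivial_of_iso_of_not_iso (hRa : OracleAdmissible R) (hν : ν ≠ iterPSum N Phi)
    {s s' : MarkedStage.{u}} (h : CycleInv k R N ν s) (hpt : s.pt ∈ Scheme.hsStratum s.W N ν)
    (hcl : IsClosed ({s.pt} : Set s.W)) {f : s'.W ⟶ s.W} (hf : StepProjection R N ν s s' f) (hiso : Iso N s)
    (hni : ¬ Iso N s') : (f.base ⁻¹' {s.pt} ∩ Scheme.hsStratum s'.W N ν).Nontrivial := by
  obtain ⟨Z', hZ', hcl', hnt⟩ := exists_isoStepBirth_of_iso_of_not_iso hRa hν h hpt hcl hf hiso hni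
  refine hnt.mono fun z hz => ⟨?_, componentsIn.subset hZ'.1 hz⟩
  have : f.base z ∈ closure (f.base '' Z') := subset_closure ⟨z, hz, rfl⟩
  rwa [hcl'] at this

/-! ## §4. Chain forms from a maximal origin (the binder shape of the `Moving` rows) -/

/-- **Chain form of §2**: along a chain `c` of canonical near steps from a maximal origin (admissible oracle, `ν ≠ Φ^{(N)}`), at every
stage `c m` whose marked point is isolated in the Hilbert–Samuel locus, every component of `X_{m+1}(ν)` through `x_{m+1}` collapses to
`x_m` along any step projection. [cite: CossartJannsenSaito2020, Thm. 3.10 (1), Rem. 6.29 (1)] -/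
theorem closure_image_eq_singleton_along_chain_of_iso (hRa : OracleAdmissible R) (hν : ν ≠ iterPSum N Phi) {X : Scheme.{u}}
    [IsLocallyNoetherian X] {x : X} (hX : IsMaximalOrigin p N ν X x) {c : ℕ → MarkedStage.{u}}
    (h0 : Reaches R N ν (MarkedStage.init X x) (c 0)) (hstep : ∀ n, CanonicalNearStep R N ν (c n) (c (n + 1))) {m : ℕ}
    (hiso : Iso N (c m)) {f : (c (m + 1)).W ⟶ (c m).W} (hf : StepProjection R N ν (c m) (c (m + 1)) f)
    {Z' : Set (c (m + 1)).W} (hZ' : Z' ∈ componentsThrough N ν (c (m + 1))) : closure (f.base '' Z') = {(c m).pt} := by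
  obtain ⟨k, _, hinv⟩ := exists_cycleInv_chain hRa hν hX h0 hstep
  have hreach : Reaches R N ν (MarkedStage.init X x) (c m) := reaches_chain h0 hstep m
  exact closure_image_eq_singleton_of_iso hRa hν (hinv m) (pt_mem_hsStratum_of_reaches hX.mem_stratum hreach)
    (Reaches.isClosed_pt hX.isClosed hreach) hf hiso hZ'

/-- **Chain form of D17 (i)**: along a chain `c` of canonical near steps from a maximal origin (admissible oracle, `ν ≠ Φ^{(N)}`), at
every iso → non-iso transition `m ↦ m + 1` and for every step projection `f` there is a non-trivial component of `X_{m+1}(ν)` through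
`x_{m+1}` collapsing to `x_m`. [cite: CossartJannsenSaito2020, Thm. 3.10 (1), Rem. 6.29 (1), Def. 13.3] -/
theorem exists_isoStepBirth_along_chain (hRa : OracleAdmissible R) (hν : ν ≠ iterPSum N Phi) {X : Scheme.{u}}
    [IsLocallyNoetherian X] {x : X} (hX : IsMaximalOrigin p N ν X x) {c : ℕ → MarkedStage.{u}}
    (h0 : Reaches R N ν (MarkedStage.init X x) (c 0)) (hstep : ∀ n, CanonicalNearStep R N ν (c n) (c (n + 1))) {m : ℕ}
    (hiso : Iso N (c m)) (hni : ¬ Iso N (c (m + 1))) {f : (c (m + 1)).W ⟶ (c m).W}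
    (hf : StepProjection R N ν (c m) (c (m + 1)) f) :
    ∃ Z' ∈ componentsThrough N ν (c (m + 1)), closure (f.base '' Z') = {(c m).pt} ∧ Z'.Nontrivial := by
  obtain ⟨k, _, hinv⟩ := exists_cycleInv_chain hRa hν hX h0 hstep
  have hreach : Reaches R N ν (MarkedStage.init X x) (c m) := reaches_chain h0 hstep m
  exact exists_isoStepBirth_of_iso_of_not_iso hRa hν (hinv m) (pt_mem_hsStratum_of_reaches hX.mem_stratum hreach)
    (Reaches.isClosed_pt hX.isClosed hreach) hf hiso hni

end Summit.ResolutionOfSingularities.ResolutionOfSingularities.Theorems.SigmaMaxModificationsCorridor3.Moving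

end
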